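import Mathlib.Data.ZMod.Basic
import Literature.IUT.HodgeTheaters.PuncturedEllipticCoverings
import HarnessLib

/-!
# [IUTchI] Corollary 1.2, proof p. 39: the cusp-recovery and splitting steps — proof-only kernels

Mochizuki, *Inter-universal Teichmüller theory I*, kurims manuscript (May 2020), §1, Corollary 1.2
"Characteristic Nature of Coverings", PROOF, p. 39 ([IUTchI] Cor 1.2 p.39)
[claim: Mochizuki2012, status: disputed].  Proof-only companion (no definitions, nothing restated) of
abc-iut-L5-t1's `PuncturedEllipticCoverings.lean` (imported, not edited), completing the
group-theoretic steps of the printed proof that the companions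
`PuncturedEllipticCoveringsCharacteristic.lean` / `PuncturedEllipticCoveringsCores.lean`
(abc-iut-L5-d4: unique intermediate subgroups, normaliser transport, core-level socket) do not
carry.  The anabelian inputs of the proof ([AbsTopI] Prop 2.3 (ii), Thm 2.6 (v)(vi), [AbsTopII]
Cor 3.3 (i)(ii), [AbsTopI] Lem 4.5) are NOT touched; no side is taken on [IUTchIII] Cor. 3.12.

* (s6) p. 39: "The conjugacy classes of the decomposition groups of `ε⁰, ε′, ε″` in `Π_X̲` may be
  recovered as the decomposition groups of cusps … whose image in `Gal(X̲→/X̲) = Π_X̲/Π_{X̲→}` is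
  nontrivial."  At the level the typed data carry — the INERTIA groups `I_x = D_x ∩ Δ_C` of the
  representative decomposition groups `D.decomp x` — this is: for a nonzero cusp `x ∉ {ε′, ε″}` the
  inertia group lies in `Π_{X→}` (it is killed in `Δ_ε`, p. 37: definitional,
  `inertia_le_piXarrow_of_ne`), whereas `I_{ε′}, I_{ε″} ⊄ Π_{X→}` under the printed claims of p. 38
  (`ArrowCoveringClaims`: `I_{ε′} ⥲ Δ_ε⁺` of order `l ≥ 5` and `Π_{X→} ∩ Δ_C = jKer`) —
  `ArrowCoveringClaims.not_inertia_le_piXarrow_iff`; and the criterion is transported by any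
  isomorphism carrying `Π_{X→}` onto `Π'_{X→}` (`map_le_piXarrow_iff`).  HONEST SCOPE: the clause for
  the zero cusp `ε⁰` (whose inertia is NOT killed) is not among the typed claims and is not asserted;
  nor is the reading with full (arithmetic) decomposition groups — the decomposition group of an
  unramified nonzero cusp need not lie in `Π_{X→}` [only its inertia group does], so the inertia-level
  form is the one recorded here.
* (s7) p. 39: "to reconstruct `Π_C̲ ⊆ Π_C`, it suffices to reconstruct the splitting of the surjection
  `Gal(X̲/C) = Π_C/Π_X̲ ↠ Π_C/Π_X = Gal(X/C)` determined by `Gal(X̲/C̲) = Π_C̲/Π_X̲`; but [since `l` is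
  prime to `3`!] this splitting may be characterized [group-theoretically!] as the unique splitting
  that stabilizes the collection of conjugacy classes of subgroups of `Π_X̲` determined by the
  decomposition groups of `ε⁰, ε′, ε″`."  Its COMBINATORIAL HEART, kernel-checked over `ZMod l`: the
  cusps of `X̲` form a `ℤ/l`-torsor on which `Gal(X̲/C)` acts through the affine maps `m ↦ ±m + b`;
  the splittings of `Gal(X̲/C) ↠ Gal(X/C) ≅ {±1}` are the reflections `m ↦ a - m` (`a ∈ ℤ/l`), the one
  determined by `C̲` being `m ↦ -m`; the three cusps are `{0, c, -c}` (`c ≠ 0` the class of `ε′`).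
  `Cor12Splitting.eq_zero_of_reflection_stabilizes`: for `l` prime to `6`, the only reflection stabilising
  `{0, c, -c}` is `a = 0` — and `Cor12Splitting.exists_ne_zero_reflection_stabilizes_three` records that for
  `l = 3` uniqueness FAILS (print's "[since `l` is prime to `3`!]").  The Π-level form consumes these
  by name once the cusp action `Π_C ↷ Cusp(X̲)` is carried by the interface (GAP-LEDGER G-L5t4g3-1,
  abc-iut-L5-t1 lineage); nothing is restated here.
* (s8) p. 39, INFO note with a kernel witness (`Cor12Splitting.exists_odd_index_chain_twentyfive`):
  "the unique maximal subgroup of odd index" of `Gal(X̲→/C̲) ≅ ℤ/2l` presumes `l` prime, while §1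
  only assumes "`l ≥ 5` an integer prime to `6`" (`l = 25`: `ℤ/50 ⊃ ⟨5⟩ ⊃ ⟨25⟩`, indices `5`, `25`);
  the tree's route (unique intermediate subgroup of index `l`, p405757) does not use the sentence.
-/

namespace Literature.IUT.HodgeTheaters

/-! ### (s7) The combinatorial heart of the splitting step, over `ZMod l` -/

namespace Cor12Splitting

/-- **Cor. 1.2, proof p. 39, "[since `l` is prime to `3`!] … the unique splitting that stabilizes
… `ε⁰, ε′, ε″`"** — combinatorial heart: for `l` prime to `6` and `c ≠ 0` in `ℤ/l`, if the
reflection `m ↦ a - m` maps each of the three cusp labels `0, c, -c` back into `{0, c, -c}`, then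
`a = 0` (i.e. the reflection is `m ↦ -m`, the one determined by `C̲`).  [`2` and `3` are units of
`ℤ/l`.] ([IUTchI] Cor 1.2 p.39) [claim: Mochizuki2012, status: disputed] -/
theorem eq_zero_of_reflection_stabilizes {l : ℕ} (hl : Nat.Coprime l 6) {c a : ZMod l}
    (hc : c ≠ 0)
    (h : ∀ m ∈ ({0, c, -c} : Set (ZMod l)), a - m ∈ ({0, c, -c} : Set (ZMod l))) :
    a = 0 := by
  -- `2` and `3` are invertible modulo `l`
  have h2 : IsUnit (2 : ZMod l) := by
    have hco : Nat.Coprime 2 l := (Nat.Coprime.coprime_dvd_right (by norm_num : 2 ∣ 6) hl).symm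
    have := (ZMod.unitOfCoprime 2 hco).isUnit
    rwa [ZMod.coe_unitOfCoprime, Nat.cast_ofNat] at this
  have h3 : IsUnit (3 : ZMod l) := by
    have hco : Nat.Coprime 3 l := (Nat.Coprime.coprime_dvd_right (by norm_num : 3 ∣ 6) hl).symm
    have := (ZMod.unitOfCoprime 3 hco).isUnit
    rwa [ZMod.coe_unitOfCoprime, Nat.cast_ofNat] at this
  -- consequences: `2c ≠ 0`, `3c ≠ 0`
  have h2c : (2 : ZMod l) * c ≠ 0 := fun h0 =>
    hc ((h2.mul_right_eq_zero).mp h0)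
  have h3c : (3 : ZMod l) * c ≠ 0 := fun h0 =>
    hc ((h3.mul_right_eq_zero).mp h0)
  -- `a = a - 0 ∈ {0, c, -c}`
  have ha : a ∈ ({0, c, -c} : Set (ZMod l)) := by simpa using h 0 (by simp)
  simp only [Set.mem_insert_iff, Set.mem_singleton_iff] at ha
  rcases ha with ha | ha | ha
  · exact ha
  · -- `a = c`: then `a - (-c) = 2c ∈ {0, c, -c}`, impossible
    exfalso
    have hm := h (-c) (by simp)
    simp only [ha, sub_neg_eq_add, Set.mem_insert_iff, Set.mem_singleton_iff] at hm
    rcases hm with hm | hm | hm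
    · exact h2c (by rw [two_mul]; exact hm)
    · apply hc
      calc c = c + c - c := by ring
        _ = 0 := by rw [hm, sub_self]
    · apply h3c
      calc (3 : ZMod l) * c = c + c + c := by ring
        _ = 0 := by rw [hm, neg_add_cancel]
  · -- `a = -c`: then `a - c = -2c ∈ {0, c, -c}`, impossible
    exfalso
    have hm := h c (by simp)
    simp only [ha, Set.mem_insert_iff, Set.mem_singleton_iff] at hm
    rcases hm with hm | hm | hm
    · apply h2c
      calc (2 : ZMod l) * c = -(-c - c) := by ring
        _ = 0 := by rw [hm, neg_zero]
    · apply h3c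
      calc (3 : ZMod l) * c = c - (-c - c) := by ring
        _ = 0 := by rw [hm, sub_self]
    · apply hc
      calc c = -c - (-c - c) := by ring
        _ = 0 := by rw [hm, sub_self]

/-- The reflection `m ↦ -m` (`a = 0`) does stabilise `{0, c, -c}`: the splitting determined by `C̲`
has the printed property. ([IUTchI] Cor 1.2 p.39) [claim: Mochizuki2012, status: disputed] -/
theorem zero_reflection_stabilizes {l : ℕ} (c : ZMod l) :
    ∀ m ∈ ({0, c, -c} : Set (ZMod l)), (0 : ZMod l) - m ∈ ({0, c, -c} : Set (ZMod l)) := by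
  intro m hm
  simp only [Set.mem_insert_iff, Set.mem_singleton_iff, zero_sub] at hm ⊢
  rcases hm with rfl | rfl | rfl
  · exact Or.inl neg_zero
  · exact Or.inr (Or.inr rfl)
  · exact Or.inr (Or.inl (neg_neg c))

/-- Uniqueness packaged: for `l` prime to `6` and `c ≠ 0`, the reflections `m ↦ a - m` of `ℤ/l`
stabilising the three cusp labels `{0, c, -c}` are EXACTLY `a = 0`. ([IUTchI] Cor 1.2 p.39)
[claim: Mochizuki2012, status: disputed] -/
theorem reflection_stabilizes_iff {l : ℕ} (hl : Nat.Coprime l 6) {c : ZMod l} (hc : c ≠ 0)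
    (a : ZMod l) :
    (∀ m ∈ ({0, c, -c} : Set (ZMod l)), a - m ∈ ({0, c, -c} : Set (ZMod l))) ↔ a = 0 :=
  ⟨eq_zero_of_reflection_stabilizes hl hc, fun ha => ha ▸ zero_reflection_stabilizes c⟩

/-- Print's caveat "[since `l` is prime to `3`!]" is NEEDED: for `l = 3` (and `c = 1`) the
reflection `m ↦ 1 - m ≠ (m ↦ -m)` also stabilises `{0, 1, -1} = ℤ/3`, so the splitting is NOT
characterised by the stabilisation property. ([IUTchI] Cor 1.2 p.39) [claim: Mochizuki2012, status: disputed] -/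
theorem exists_ne_zero_reflection_stabilizes_three :
    ∃ a : ZMod 3, a ≠ 0 ∧
      ∀ m ∈ ({0, 1, -1} : Set (ZMod 3)), a - m ∈ ({0, 1, -1} : Set (ZMod 3)) := by
  refine ⟨1, by decide, ?_⟩
  intro m hm
  simp only [Set.mem_insert_iff, Set.mem_singleton_iff] at hm ⊢
  revert m
  decide

/-- **(s8) p. 39, a print-generality NOTE (INFO; no typed statement affected).**  "(`ℤ/2ℤ ≅`)
`Gal(X̲→/C̲→) ⊆ Gal(X̲→/C̲)` (`≅ ℤ/2lℤ`) is the unique maximal subgroup of odd index" presumes `l`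
PRIME, whereas §1's standing hypothesis is only "`l ≥ 5` an integer prime to `6`" (p. 37): for
`l = 25` the cyclic group `ℤ/50` contains the chain of PROPER subgroups `⟨25⟩ < ⟨5⟩` of orders `2`,
`10` and ODD indices `25`, `5`, so the order-`2` subgroup is not maximal among the subgroups of odd
index.  (The tree's route, abc-iut-L5-d4's `ArrowCoveringClaims.map_subgroupOf_piCarrow_eq`
(p405757) — the unique intermediate subgroup of INDEX `l` — does not use this sentence; [IUTchI]
Def. 3.1 takes `l` prime.) ([IUTchI] Cor 1.2 p.39) [claim: Mochizuki2012, status: disputed] -/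
theorem exists_odd_index_chain_twentyfive :
    Nat.card (AddSubgroup.zmultiples (25 : ZMod 50)) = 2 ∧
      Nat.card (AddSubgroup.zmultiples (5 : ZMod 50)) = 10 ∧
      (AddSubgroup.zmultiples (25 : ZMod 50)).index = 25 ∧
      (AddSubgroup.zmultiples (5 : ZMod 50)).index = 5 ∧
      AddSubgroup.zmultiples (25 : ZMod 50) < AddSubgroup.zmultiples (5 : ZMod 50) ∧
      AddSubgroup.zmultiples (5 : ZMod 50) ≠ ⊤ := by
  have hA : Nat.card (AddSubgroup.zmultiples (25 : ZMod 50)) = 2 := by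
    rw [Nat.card_zmultiples, show (25 : ZMod 50) = ((25 : ℕ) : ZMod 50) by norm_cast,
      ZMod.addOrderOf_coe 25 (by norm_num)]
    decide
  have hB : Nat.card (AddSubgroup.zmultiples (5 : ZMod 50)) = 10 := by
    rw [Nat.card_zmultiples, show (5 : ZMod 50) = ((5 : ℕ) : ZMod 50) by norm_cast,
      ZMod.addOrderOf_coe 5 (by norm_num)]
    decide
  have hG : Nat.card (ZMod 50) = 50 := Nat.card_zmod 50
  have hiA := (AddSubgroup.zmultiples (25 : ZMod 50)).index_mul_card
  have hiB := (AddSubgroup.zmultiples (5 : ZMod 50)).index_mul_card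
  rw [hA, hG] at hiA
  rw [hB, hG] at hiB
  refine ⟨hA, hB, by omega, by omega, lt_of_le_of_ne ?_ ?_, ?_⟩
  · rw [AddSubgroup.zmultiples_le, AddSubgroup.mem_zmultiples_iff]
    exact ⟨5, by decide⟩
  · intro h
    have := congrArg (fun H : AddSubgroup (ZMod 50) => Nat.card H) h
    simp only [hA, hB] at this
    omega
  · intro h
    have := congrArg (fun H : AddSubgroup (ZMod 50) => Nat.card H) h
    simp only [hB, AddSubgroup.card_top, hG] at this
    omega

end Cor12Splitting

/-! ### (s6) Cusps of `X̲` ramified in `X̲→ → X̲`: the inertia-level criterion -/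

namespace PuncturedEllipticData

open Literature.AnabelianGeometry.AbsoluteAnabelian

universe u

variable (D : PuncturedEllipticData.{u})

/-- **Cor. 1.2, proof p. 39 (s6), unramified side — definitional:** for a NONZERO cusp `x` of `X̲`
other than `ε′, ε″`, the inertia group `I_x` lies in `Π_{X→}` (it is killed in
`Δ_X̲ ↠ Δ_ε`, p. 37, hence lies in `jKer ⊆ Π_{X→}`): its image in `Gal(X̲→/X̲)` is trivial.
([IUTchI] Cor 1.2 p.39) [claim: Mochizuki2012, status: disputed] -/
theorem inertia_le_piXarrow_of_ne {x : D.Cusp} (hx : D.IsNonzeroCusp x) (h1 : x ≠ D.ε1)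
    (h2 : x ≠ D.ε2) : D.inertia x ≤ D.piXarrow := by
  have hI : D.inertia x ≤ D.deltaEpsKer := by
    refine le_trans ?_ (le_sup_right : _ ≤ D.modLKer ⊔ _)
    exact le_iSup (fun y : {y : D.Cusp // D.IsNonzeroCusp y ∧ y ≠ D.ε1 ∧ y ≠ D.ε2} => D.inertia y.1)
      ⟨x, hx, h1, h2⟩
  exact hI.trans ((le_sup_left : D.deltaEpsKer ≤ D.jKer).trans (le_sup_right : D.jKer ≤ D.piXarrow))

variable {D}

/-- **Cor. 1.2, proof p. 39 (s6), ramified side:** under the printed claims of p. 38, the inertia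
group of `ε′` does NOT lie in `Π_{X→}` — it maps isomorphically onto `Δ_ε⁺ = Δ_X̲/jKer` of order
`l ≥ 5`, while `Π_{X→} ∩ Δ_C = jKer`. ([IUTchI] Cor 1.2 p.39) [claim: Mochizuki2012, status: disputed] -/
theorem ArrowCoveringClaims.not_inertia_ε1_le_piXarrow (h : D.ArrowCoveringClaims) :
    ¬ D.inertia D.ε1 ≤ D.piXarrow := by
  intro hle
  -- `I_{ε′} ⊆ Π_{X→} ∩ Δ_C = jKer`
  have hj : D.inertia D.ε1 ≤ D.jKer := by
    rw [← h.piXarrow_inf_delta]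
    exact le_inf hle (inf_le_right : D.decomp D.ε1 ⊓ D.DeltaC ≤ D.DeltaC)
  -- hence `Δ_X̲ = I_{ε′} ⊔ jKer = jKer`, contradicting `[Δ_X̲ : jKer] = l ≥ 5`
  have hΔ : D.DeltaXbar = D.jKer := by rw [← h.inertia_ε1_sup]; exact sup_eq_right.mpr hj
  have hl : D.jKer.relIndex D.DeltaXbar = 1 := by rw [hΔ, Subgroup.relIndex_self]
  rw [h.jKer_relindex] at hl
  have := D.five_le
  omega

/-- **Cor. 1.2, proof p. 39 (s6), ramified side for `ε″`.** ([IUTchI] Cor 1.2 p.39)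
[claim: Mochizuki2012, status: disputed] -/
theorem ArrowCoveringClaims.not_inertia_ε2_le_piXarrow (h : D.ArrowCoveringClaims) :
    ¬ D.inertia D.ε2 ≤ D.piXarrow := by
  intro hle
  have hj : D.inertia D.ε2 ≤ D.jKer := by
    rw [← h.piXarrow_inf_delta]
    exact le_inf hle (inf_le_right : D.decomp D.ε2 ⊓ D.DeltaC ≤ D.DeltaC)
  have hΔ : D.DeltaXbar = D.jKer := by rw [← h.inertia_ε2_sup]; exact sup_eq_right.mpr hj
  have hl : D.jKer.relIndex D.DeltaXbar = 1 := by rw [hΔ, Subgroup.relIndex_self]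
  rw [h.jKer_relindex] at hl
  have := D.five_le
  omega

/-- **Cor. 1.2, proof p. 39 (s6), the inertia-level criterion among the NONZERO cusps:** under
the printed claims of p. 38, a nonzero cusp `x` of `X̲` has inertia group NOT contained in
`Π_{X→}` [nontrivial image in `Gal(X̲→/X̲)`] iff `x ∈ {ε′, ε″}`.  (The zero cusp `ε⁰` is also
ramified in print; its clause is not among the typed claims and is not asserted here.)
([IUTchI] Cor 1.2 p.39) [claim: Mochizuki2012, status: disputed] -/
theorem ArrowCoveringClaims.not_inertia_le_piXarrow_iff (h : D.ArrowCoveringClaims) {x : D.Cusp}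
    (hx : D.IsNonzeroCusp x) : ¬ D.inertia x ≤ D.piXarrow ↔ x = D.ε1 ∨ x = D.ε2 := by
  constructor
  · intro hn
    by_contra hne
    push Not at hne
    exact hn (D.inertia_le_piXarrow_of_ne hx hne.1 hne.2)
  · rintro (rfl | rfl)
    · exact h.not_inertia_ε1_le_piXarrow
    · exact h.not_inertia_ε2_le_piXarrow

/-- **Transport (s6):** the criterion "`I ⊄ Π_{X→}`" is carried by any isomorphism `Θ : Π_C ⥲ Π'_C`
with `Θ(Π_{X→}) = Π'_{X→}` [as supplied by the functorial reconstruction of `Π_C` from `Π_{X→}`]: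
`Θ(I) ⊆ Π'_{X→} ↔ I ⊆ Π_{X→}` for every subgroup `I`. ([IUTchI] Cor 1.2 p.39)
[claim: Mochizuki2012, status: disputed] -/
theorem map_le_piXarrow_iff {D' : PuncturedEllipticData.{u}} (Θ : D.PiC ≃* D'.PiC)
    (hΘ : D.piXarrow.map Θ.toMonoidHom = D'.piXarrow) (I : Subgroup D.PiC) :
    I.map Θ.toMonoidHom ≤ D'.piXarrow ↔ I ≤ D.piXarrow := by
  rw [← hΘ]
  exact Subgroup.map_le_map_iff_of_injective Θ.injective

end PuncturedEllipticData

end Literature.IUT.HodgeTheaters
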